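import Summits.SmoothPoincare4.SmoothPoincare4.Theorems.CongruenceShadowsLieGateIdentityGeneral

/-!
# The Lie gate identity (`LieGateIdentity`) for the stabilised `S⁴` trisection

Support file for item stmt-SmoothPoincare4-13527 (`LieGateIdentity`, route
`SmoothPoincare4/CongruenceShadows`, card artin-approximation-trisection-groups K1 (ii)+(iii)),
over the definitions of `Literature/Algebra/Lie/SurfaceLieAlgebra.lean` (`SurfaceLieAlgebra R g`,
`grade`, `derDegree`, `cutIdeal`, `cutStabilizerDegree`, `s4CutSystem`).

The item's GATE and PAIR statements, for every `m`, every degree `n` and every commutative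
coefficient ring `R` (in particular `ℚ` and `ℤ`), for the three coordinate cut systems
`s4CutSystem m 0, 1, 2 ⊆ Fin (3 + 3m) × Bool` of `s4Kernels.stabilizeIter m` (the patterns
`s4Gens i = {a₁,a₂,b₃}, {a₁,b₂,a₃}, {b₁,a₂,a₃}` repeated blockwise), with
`𝔞, 𝔟, 𝔠 = cutStabilizerDegree R (3+3m) (s4CutSystem m 0/1/2) n ⊆ Der_n(𝔰_{3+3m}(R))`:
* `lieGateIdentity`: `(𝔞 ⊔ 𝔠) ⊓ (𝔟 ⊔ 𝔠) = (𝔞 ⊓ 𝔟) ⊔ 𝔠` (and `lieGateIdentity_perm` for any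
  labelling of the three systems);
* `liePairIdentity`: `D ∈ 𝔞_i ⊔ 𝔞_j ↔ D ∈ Der_n ∧ ∀ x ∈ C_i ∩ C_j, D (gen x) ∈ I_i ⊔ I_j`;
* `derDegree_eq_sup_cutStabilizerDegree`: `Der_n = 𝔞 ⊔ 𝔟 ⊔ 𝔠` (every degree-`n` derivation
  decomposes along the trisection; the inclusion–exclusion form of GATE, see the last section).
The first two are specialisations of `gate_general` / `pair_general`
(`CongruenceShadowsLieGateIdentityGeneral.lean`): the `s4Gens` patterns are coordinate and no
letter lies in all three (`decide`).  This settles the GATE part of the informal item in every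
degree (the card had verified `(g,n) = (3,1…5), (6,1…3), (9,1…2)` by linear algebra) and the
linear PAIR lemma; the Hensel-iteration consequence for Malcev completions stated informally in
the item is not formalised here (no Malcev completion in the tree).

No new definitions, no named facts.
-/

-- the prescribed namespace `Summit.<P>.<Sub>.…` duplicates `SmoothPoincare4` (P = Sub)
set_option linter.dupNamespace false

open Literature.Algebra.Lie Literature.Algebra.Lie.SurfaceLieAlgebra

namespace Summit.SmoothPoincare4.SmoothPoincare4.Theorems.LieGateIdentity

/-! ## The coordinate cut systems of the stabilised `S⁴` trisection -/

section S4

open Literature.Topology.FourManifolds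

/-- The `s4Gens` patterns are coordinate: exactly one letter of every handle. [folklore] -/
theorem s4Gens_coord : ∀ (y : Fin 3) (ε : Bool) (i : Fin 3),
    (y, ε) ∈ s4Gens i ↔ (y, !ε) ∉ s4Gens i := by decide

/-- No letter lies in all three `s4Gens` patterns (for any labelling). [folklore] -/
theorem s4Gens_not_mem_three : ∀ (y : Fin 3 × Bool) (i j k : Fin 3), i ≠ j → i ≠ k → j ≠ k →
    y ∈ s4Gens i → y ∈ s4Gens j → y ∉ s4Gens k := by decide

/-- The coordinate cut systems `s4CutSystem m i` are coordinate. [folklore] -/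
theorem s4CutSystem_coord (m : ℕ) (i : Fin 3) (x : Fin (3 + 3 * m) × Bool) :
    x ∈ s4CutSystem m i ↔ (x.1, !x.2) ∉ s4CutSystem m i :=
  s4Gens_coord _ x.2 i

/-- No letter lies in three distinct coordinate cut systems of the stabilised `S⁴` trisection.
[folklore] -/
theorem s4CutSystem_not_mem_three (m : ℕ) {i j k : Fin 3} (hij : i ≠ j) (hik : i ≠ k)
    (hjk : j ≠ k) (x : Fin (3 + 3 * m) × Bool) :
    x ∈ s4CutSystem m i → x ∈ s4CutSystem m j → x ∉ s4CutSystem m k :=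
  s4Gens_not_mem_three _ i j k hij hik hjk

end S4

end Summit.SmoothPoincare4.SmoothPoincare4.Theorems.LieGateIdentity

/-! ## The Lie gate identity and the pair identity for the stabilised `S⁴` trisection -/

namespace Summit.SmoothPoincare4.SmoothPoincare4.Theorems

open Literature.Algebra.Lie Literature.Algebra.Lie.SurfaceLieAlgebra LieGateIdentity

/-- **Lie gate identity** (`LieGateIdentity`, GATE, card artin-approximation-trisection-groups
K1 (iii)), for every `m`, every degree `n` and every commutative coefficient ring `R`: in
`Der_n(𝔰_{3+3m}(R))` the degree-`n` stabilisers `𝔞, 𝔟, 𝔠` of the cut ideals of the three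
coordinate cut systems `s4CutSystem m 0, 1, 2` of `s4Kernels.stabilizeIter m` satisfy
`(𝔞 + 𝔠) ∩ (𝔟 + 𝔠) = (𝔞 ∩ 𝔟) + 𝔠`. [folklore] -/
theorem lieGateIdentity (R : Type*) [CommRing R] (m n : ℕ) :
    (cutStabilizerDegree R (3 + 3 * m) (s4CutSystem m 0) n ⊔
        cutStabilizerDegree R (3 + 3 * m) (s4CutSystem m 2) n) ⊓
      (cutStabilizerDegree R (3 + 3 * m) (s4CutSystem m 1) n ⊔
        cutStabilizerDegree R (3 + 3 * m) (s4CutSystem m 2) n) =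
    (cutStabilizerDegree R (3 + 3 * m) (s4CutSystem m 0) n ⊓
        cutStabilizerDegree R (3 + 3 * m) (s4CutSystem m 1) n) ⊔
      cutStabilizerDegree R (3 + 3 * m) (s4CutSystem m 2) n :=
  gate_general (s4CutSystem_coord m 0) (s4CutSystem_coord m 1) (s4CutSystem_coord m 2)
    (s4CutSystem_not_mem_three m (i := 0) (j := 1) (k := 2) (by decide) (by decide) (by decide)) n

/-- The Lie gate identity for any labelling `i, j, k` of the three cut systems. [folklore] -/
theorem lieGateIdentity_perm (R : Type*) [CommRing R] (m n : ℕ) {i j k : Fin 3} (hij : i ≠ j)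
    (hik : i ≠ k) (hjk : j ≠ k) :
    (cutStabilizerDegree R (3 + 3 * m) (s4CutSystem m i) n ⊔
        cutStabilizerDegree R (3 + 3 * m) (s4CutSystem m k) n) ⊓
      (cutStabilizerDegree R (3 + 3 * m) (s4CutSystem m j) n ⊔
        cutStabilizerDegree R (3 + 3 * m) (s4CutSystem m k) n) =
    (cutStabilizerDegree R (3 + 3 * m) (s4CutSystem m i) n ⊓
        cutStabilizerDegree R (3 + 3 * m) (s4CutSystem m j) n) ⊔
      cutStabilizerDegree R (3 + 3 * m) (s4CutSystem m k) n :=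
  gate_general (s4CutSystem_coord m i) (s4CutSystem_coord m j) (s4CutSystem_coord m k)
    (s4CutSystem_not_mem_three m hij hik hjk) n

/-- **Pair identity** (`LieGateIdentity`, PAIR): a degree-`n` derivation of `𝔰_{3+3m}(R)` is a
sum `D_i + D_j` of derivations stabilising the cut ideals `I_i`, `I_j` of two coordinate
cut systems iff it sends their common letters into `I_i + I_j` — the linear constraint a
deformation of the pair of ideals satisfies. [folklore] -/
theorem liePairIdentity (R : Type*) [CommRing R] (m n : ℕ) (i j : Fin 3)
    (D : LieDerivation R (SurfaceLieAlgebra R (3 + 3 * m)) (SurfaceLieAlgebra R (3 + 3 * m))) :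
    D ∈ cutStabilizerDegree R (3 + 3 * m) (s4CutSystem m i) n ⊔
        cutStabilizerDegree R (3 + 3 * m) (s4CutSystem m j) n ↔
      D ∈ derDegree R (3 + 3 * m) n ∧
        ∀ x, x ∈ s4CutSystem m i → x ∈ s4CutSystem m j →
          D (gen R (3 + 3 * m) x) ∈
            cutIdeal R (3 + 3 * m) (s4CutSystem m i) ⊔ cutIdeal R (3 + 3 * m) (s4CutSystem m j) :=
  pair_general (s4CutSystem_coord m i) (s4CutSystem_coord m j) n D

end Summit.SmoothPoincare4.SmoothPoincare4.Theorems

/-! ## Every positive-degree derivation decomposes along the trisection: `Der_n = 𝔞 + 𝔟 + 𝔠`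

The inclusion–exclusion form of the gate identity: for three coordinate cut systems with no common
letter, **every** degree-`n` derivation of `𝔰_g(R)` is a sum of three derivations stabilising the
cut ideals (`derDegree_eq_sup_three`); for the stabilised `S⁴` trisection,
`derDegree R (3+3m) n = 𝔞 ⊔ 𝔟 ⊔ 𝔠` (`derDegree_eq_sup_cutStabilizerDegree`).  Over a field this and
GATE are equivalent by the dimension count `δ(𝔞,𝔟,𝔠) = dim Der_n - dim (𝔞 + 𝔟 + 𝔠)` for the
distributivity defect `δ`; here it is proved directly by the same chase: split the data of `D`
letterwise as `p_A + p_B + p_C` with `p_S` vanishing on `S`, resolve `Φ p_C ∈ I_C ∩ (I_A + I_B)` by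
the word calculus (`exists_split_correction`) and the remaining element of `I_A ∩ I_B` by
`exists_correction₂`. -/

namespace Summit.SmoothPoincare4.SmoothPoincare4.Theorems.LieGateIdentity

section Decomposition

variable {R : Type*} [CommRing R] {g : ℕ}

/-- **Graded splitting of `I_C ∩ (I_A + I_B)`.** An element of bracket length `d + 2` lying in
`I_C` and in `I_A + I_B` (all three systems coordinate) is `Φ r₁ + Φ r₂` for correction data `r₁`
in the `A`- and `C`-conditions and `r₂` in the `B`- and `C`-conditions: it lies in the span of the
words touching `C` and `A ∪ B`, and each such word touches `A` or `B`. [folklore] -/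
theorem exists_split_correction {A B C : Set (Fin g × Bool)}
    (hA : ∀ x : Fin g × Bool, x ∈ A ↔ (x.1, !x.2) ∉ A)
    (hB : ∀ x : Fin g × Bool, x ∈ B ↔ (x.1, !x.2) ∉ B)
    (hC : ∀ x : Fin g × Bool, x ∈ C ↔ (x.1, !x.2) ∉ C) {n : ℕ} {u : SurfaceLieAlgebra R g}
    (hu : u ∈ grade R g (n + 2)) (huC : u ∈ cutIdeal R g C)
    (huAB : u ∈ cutIdeal R g A ⊔ cutIdeal R g B) :
    ∃ r₁ r₂ : Fin g × Bool → SurfaceLieAlgebra R g, (∀ x, r₁ x ∈ grade R g (n + 1)) ∧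
      (∀ x ∈ A, r₁ x ∈ cutIdeal R g A) ∧ (∀ x ∈ C, r₁ x ∈ cutIdeal R g C) ∧
      (∀ x, r₂ x ∈ grade R g (n + 1)) ∧
      (∀ x ∈ B, r₂ x ∈ cutIdeal R g B) ∧ (∀ x ∈ C, r₂ x ∈ cutIdeal R g C) ∧
      (∑ i : Fin g, (⁅a R g i, r₁ (i, true)⁆ - ⁅b R g i, r₁ (i, false)⁆)) + (∑ i : Fin g, (⁅a R g i,
          r₂ (i, true)⁆ - ⁅b R g i, r₂ (i, false)⁆)) = u := by
  have hAB : ∀ i : Fin g, (i, false) ∈ A ∪ B ∨ (i, true) ∈ A ∪ B :=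
    fun i => (hits_of_coord hA i).imp (Set.mem_union_left _ ·) (Set.mem_union_left _ ·)
  have hu' : u ∈ Submodule.span R (bracketWord (gen R g) '' {w | w.length = n + 2}) := hu
  have huAB' : u ∈ cutIdeal R g (A ∪ B) := by
    have : cutIdeal R g (A ∪ B) = cutIdeal R g A ⊔ cutIdeal R g B := by
      change LieSubmodule.lieSpan R _ (gen R g '' (A ∪ B)) = _
      rw [Set.image_union, LieSubmodule.span_union]; rfl
    rw [this]; exact huAB
  have h := mem_span_touch hAB (mem_span_touch (hits_of_coord hC) hu' huC) huAB'
  have hsplit : Submodule.span R (bracketWord (gen R g) ''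
      {w | (w.length = n + 2 ∧ ∃ x ∈ (FreeMagma.lift (fun x => Multiplicative.ofAdd ({x} : Multiset
          _)) w).toAdd, x ∈ C) ∧ ∃ x ∈ (FreeMagma.lift (fun x => Multiplicative.ofAdd ({x} :
          Multiset _)) w).toAdd, x ∈ A ∪ B}) ≤
      Submodule.span R (bracketWord (gen R g) ''
        {w | (w.length = n + 2 ∧ ∃ x ∈ (FreeMagma.lift (fun x => Multiplicative.ofAdd ({x} :
            Multiset _)) w).toAdd, x ∈ A) ∧ ∃ x ∈ (FreeMagma.lift (fun x => Multiplicative.ofAdd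
            ({x} : Multiset _)) w).toAdd, x ∈ C}) ⊔
      Submodule.span R (bracketWord (gen R g) ''
        {w | (w.length = n + 2 ∧ ∃ x ∈ (FreeMagma.lift (fun x => Multiplicative.ofAdd ({x} :
            Multiset _)) w).toAdd, x ∈ B) ∧ ∃ x ∈ (FreeMagma.lift (fun x => Multiplicative.ofAdd
            ({x} : Multiset _)) w).toAdd, x ∈ C}) := by
    rw [Submodule.span_le]
    rintro _ ⟨w, ⟨⟨hw, hwC⟩, x, hx, hxA | hxB⟩, rfl⟩
    · exact Submodule.mem_sup_left (Submodule.subset_span ⟨w, ⟨⟨hw, x, hx, hxA⟩, hwC⟩, rfl⟩)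
    · exact Submodule.mem_sup_right (Submodule.subset_span ⟨w, ⟨⟨hw, x, hx, hxB⟩, hwC⟩, rfl⟩)
  obtain ⟨u₁, hu₁, u₂, hu₂, rfl⟩ := Submodule.mem_sup.1 (hsplit h)
  obtain ⟨r₁, hr₁, hr₁T, hr₁q⟩ := exists_data (R := R) (T := fun S => S = A ∨ S = C)
    (by rintro S (rfl | rfl) <;> assumption) (d := n)
    (W := {w | (w.length = n + 2 ∧ ∃ x ∈ (FreeMagma.lift (fun x => Multiplicative.ofAdd ({x} :
        Multiset _)) w).toAdd, x ∈ A) ∧ ∃ x ∈ (FreeMagma.lift (fun x => Multiplicative.ofAdd ({x} :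
        Multiset _)) w).toAdd, x ∈ C})
    (by
      rintro w ⟨⟨hl, hwA⟩, hwC⟩
      exact ⟨hl, by rintro S (rfl | rfl) <;> assumption⟩) hu₁
  obtain ⟨r₂, hr₂, hr₂T, hr₂q⟩ := exists_data (R := R) (T := fun S => S = B ∨ S = C)
    (by rintro S (rfl | rfl) <;> assumption) (d := n)
    (W := {w | (w.length = n + 2 ∧ ∃ x ∈ (FreeMagma.lift (fun x => Multiplicative.ofAdd ({x} :
        Multiset _)) w).toAdd, x ∈ B) ∧ ∃ x ∈ (FreeMagma.lift (fun x => Multiplicative.ofAdd ({x} :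
        Multiset _)) w).toAdd, x ∈ C})
    (by
      rintro w ⟨⟨hl, hwB⟩, hwC⟩
      exact ⟨hl, by rintro S (rfl | rfl) <;> assumption⟩) hu₂
  exact ⟨r₁, r₂, hr₁, hr₁T A (Or.inl rfl), hr₁T C (Or.inr rfl), hr₂, hr₂T B (Or.inl rfl),
    hr₂T C (Or.inr rfl), by rw [hr₁q, hr₂q]⟩

/-- **Decomposition of derivations, general form.** For three coordinate cut systems with no
common letter, every degree-`n` derivation of `𝔰_g(R)` is a sum of three derivations stabilising
the three cut ideals: `Der_n = 𝔞 + 𝔟 + 𝔠` (the form of the gate identity obtained by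
inclusion–exclusion).  Proof: split the data of `D` letterwise as `p_A + p_B + p_C` with `p_S`
vanishing on `S`; the relation `Φ p_A + Φ p_B + Φ p_C = 0` with `Φ p_S ∈ I_S` is resolved by two
corrections (`exists_split_correction` for `Φ p_C ∈ I_C ∩ (I_A + I_B)`, then
`exists_correction₂` for the remaining element of `I_A ∩ I_B`). [folklore] -/
theorem derDegree_eq_sup_three {A B C : Set (Fin g × Bool)}
    (hA : ∀ x : Fin g × Bool, x ∈ A ↔ (x.1, !x.2) ∉ A)
    (hB : ∀ x : Fin g × Bool, x ∈ B ↔ (x.1, !x.2) ∉ B)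
    (hC : ∀ x : Fin g × Bool, x ∈ C ↔ (x.1, !x.2) ∉ C)
    (hABC : ∀ x, x ∈ A → x ∈ B → x ∉ C) (n : ℕ) :
    derDegree R g n =
      cutStabilizerDegree R g A n ⊔ cutStabilizerDegree R g B n ⊔ cutStabilizerDegree R g C n := by
  classical
  refine le_antisymm ?_ (sup_le (sup_le inf_le_right inf_le_right) inf_le_right)
  intro D hD
  have hgr : ∀ x, D (gen R g x) ∈ grade R g (n + 1) := mem_derDegree_iff.1 hD
  -- letterwise splitting of the data of `D`
  let pA : Fin g × Bool → SurfaceLieAlgebra R g := fun x => if x ∈ A then 0 else D (gen R g x)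
  let pB : Fin g × Bool → SurfaceLieAlgebra R g := fun x =>
    if x ∈ A then (if x ∈ B then 0 else D (gen R g x)) else 0
  let pC : Fin g × Bool → SurfaceLieAlgebra R g := fun x =>
    if x ∈ A then (if x ∈ B then D (gen R g x) else 0) else 0
  have hsum : ∀ x, pA x + pB x + pC x = D (gen R g x) := by
    intro x
    by_cases hxA : x ∈ A <;> by_cases hxB : x ∈ B <;> simp [pA, pB, pC, hxA, hxB]
  have hpA_grade : ∀ x, pA x ∈ grade R g (n + 1) := by
    intro x
    by_cases hxA : x ∈ A <;> simp only [pA, hxA, if_true, if_false]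
    · exact Submodule.zero_mem _
    · exact hgr x
  have hpB_grade : ∀ x, pB x ∈ grade R g (n + 1) := by
    intro x
    by_cases hxA : x ∈ A <;> by_cases hxB : x ∈ B <;>
      simp only [pB, hxA, hxB, if_true, if_false] <;>
      first
        | exact Submodule.zero_mem _
        | exact hgr x
  have hpC_grade : ∀ x, pC x ∈ grade R g (n + 1) := by
    intro x
    by_cases hxA : x ∈ A <;> by_cases hxB : x ∈ B <;>
      simp only [pC, hxA, hxB, if_true, if_false] <;>
      first
        | exact Submodule.zero_mem _
        | exact hgr x
  have hpA_A : ∀ x ∈ A, pA x ∈ cutIdeal R g A := by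
    intro x hxA; simp only [pA, hxA, if_true]; exact LieSubmodule.zero_mem _
  have hpB_B : ∀ x ∈ B, pB x ∈ cutIdeal R g B := by
    intro x hxB
    by_cases hxA : x ∈ A <;> simp only [pB, hxA, hxB, if_true, if_false] <;>
      exact LieSubmodule.zero_mem _
  have hpC_C : ∀ x ∈ C, pC x ∈ cutIdeal R g C := by
    intro x hxC
    by_cases hxA : x ∈ A <;> by_cases hxB : x ∈ B <;> simp only [pC, hxA, hxB, if_true, if_false]
    · exact absurd hxC (hABC x hxA hxB)
    all_goals exact LieSubmodule.zero_mem _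
  -- the relation among the three `Φ`'s
  have hΦ : (∑ i : Fin g, (⁅a R g i, pA (i, true)⁆ - ⁅b R g i, pA (i, false)⁆)) + (∑ i : Fin g, (⁅a
      R g i, pB (i, true)⁆ - ⁅b R g i, pB (i, false)⁆)) + (∑ i : Fin g, (⁅a R g i, pC (i, true)⁆ -
      ⁅b R g i, pC (i, false)⁆)) = 0 := by
    rw [← phi_add, ← phi_add,
      show pA + pB + pC = fun x => D (gen R g x) from funext fun x => hsum x]
    exact phi_derivation D
  have huA : (∑ i : Fin g, (⁅a R g i, pA (i, true)⁆ - ⁅b R g i, pA (i, false)⁆)) ∈ cutIdeal R g A :=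
      phi_mem_cutIdeal (hits_of_coord hA) hpA_A
  have huB : (∑ i : Fin g, (⁅a R g i, pB (i, true)⁆ - ⁅b R g i, pB (i, false)⁆)) ∈ cutIdeal R g B :=
      phi_mem_cutIdeal (hits_of_coord hB) hpB_B
  have huC : (∑ i : Fin g, (⁅a R g i, pC (i, true)⁆ - ⁅b R g i, pC (i, false)⁆)) ∈ cutIdeal R g C :=
      phi_mem_cutIdeal (hits_of_coord hC) hpC_C
  have hCeq : (∑ i : Fin g, (⁅a R g i, pC (i, true)⁆ - ⁅b R g i, pC (i, false)⁆)) = -((∑ i : Fin g,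
      (⁅a R g i, pA (i, true)⁆ - ⁅b R g i, pA (i, false)⁆)) + (∑ i : Fin g, (⁅a R g i, pB (i, true)⁆
      - ⁅b R g i, pB (i, false)⁆))) := eq_neg_of_add_eq_zero_right hΦ
  have huAB : (∑ i : Fin g, (⁅a R g i, pC (i, true)⁆ - ⁅b R g i, pC (i, false)⁆)) ∈ cutIdeal R g A ⊔
      cutIdeal R g B := by
    rw [hCeq, neg_add]
    exact add_mem (LieSubmodule.mem_sup_left (neg_mem huA))
      (LieSubmodule.mem_sup_right (neg_mem huB))
  -- first correction: resolve `Φ p_C`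
  obtain ⟨r₁, r₂, hr₁, hr₁A, hr₁C, hr₂, hr₂B, hr₂C, hr⟩ :=
    exists_split_correction hA hB hC (phi_mem_grade hpC_grade) huC huAB
  -- second correction: the remaining element of `I_A ∩ I_B`
  have hw_eq : (∑ i : Fin g, (⁅a R g i, (pA + r₁) (i, true)⁆ - ⁅b R g i, (pA + r₁) (i, false)⁆)) +
      (∑ i : Fin g, (⁅a R g i, (pB + r₂) (i, true)⁆ - ⁅b R g i, (pB + r₂) (i, false)⁆)) = 0 := by
    rw [phi_add, phi_add, add_add_add_comm, hr, ← hΦ]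
  have hwA : (∑ i : Fin g, (⁅a R g i, (pA + r₁) (i, true)⁆ - ⁅b R g i, (pA + r₁) (i, false)⁆)) ∈
      cutIdeal R g A :=
    phi_mem_cutIdeal (hits_of_coord hA) fun x hx => add_mem (hpA_A x hx) (hr₁A x hx)
  have hwB : (∑ i : Fin g, (⁅a R g i, (pA + r₁) (i, true)⁆ - ⁅b R g i, (pA + r₁) (i, false)⁆)) ∈
      cutIdeal R g B := by
    have h1 : (∑ i : Fin g, (⁅a R g i, (pB + r₂) (i, true)⁆ - ⁅b R g i, (pB + r₂) (i, false)⁆)) ∈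
        cutIdeal R g B :=
      phi_mem_cutIdeal (hits_of_coord hB) fun x hx => add_mem (hpB_B x hx) (hr₂B x hx)
    rw [eq_neg_of_add_eq_zero_right hw_eq] at h1
    exact neg_mem_iff.1 h1
  have hw_grade : (∑ i : Fin g, (⁅a R g i, (pA + r₁) (i, true)⁆ - ⁅b R g i, (pA + r₁) (i, false)⁆))
      ∈ grade R g (n + 2) :=
    phi_mem_grade fun x => add_mem (hpA_grade x) (hr₁ x)
  obtain ⟨s, hs, hsA, hsB, hsq⟩ := exists_correction₂ hA hB hw_grade hwA hwB
  -- the three derivations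
  obtain ⟨EA, hEA⟩ := exists_derivation (pA + r₁ - s) (by
    have := phi_sub (pA + r₁) s
    rw [hsq, sub_self] at this
    simpa [a, b] using this)
  obtain ⟨EB, hEB⟩ := exists_derivation (pB + r₂ + s) (by
    have := phi_add (pB + r₂) s
    rw [hsq, eq_neg_of_add_eq_zero_right hw_eq, neg_add_cancel] at this
    simpa [a, b] using this)
  obtain ⟨EC, hEC⟩ := exists_derivation (pC - r₁ - r₂) (by
    have h1 : (∑ i : Fin g, (⁅a R g i, (pC - r₁ - r₂) (i, true)⁆ - ⁅b R g i, (pC - r₁ - r₂) (i,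
        false)⁆)) = (∑ i : Fin g, (⁅a R g i, pC (i, true)⁆ - ⁅b R g i, pC (i, false)⁆)) - (∑ i : Fin
        g, (⁅a R g i, r₁ (i, true)⁆ - ⁅b R g i, r₁ (i, false)⁆)) - (∑ i : Fin g, (⁅a R g i, r₂ (i,
        true)⁆ - ⁅b R g i, r₂ (i, false)⁆)) := by rw [phi_sub, phi_sub]
    rw [← hr] at h1
    have h2 : (∑ i : Fin g, (⁅a R g i, (pC - r₁ - r₂) (i, true)⁆ - ⁅b R g i, (pC - r₁ - r₂) (i,
        false)⁆)) = 0 := by rw [h1]; abel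
    simpa [a, b] using h2)
  have hEA' : EA ∈ cutStabilizerDegree R g A n :=
    mem_cutStabilizerDegree_of_gen
      (fun x hx => by rw [hEA]; exact sub_mem (add_mem (hpA_A x hx) (hr₁A x hx)) (hsA x hx))
      fun x => by rw [hEA]; exact sub_mem (add_mem (hpA_grade x) (hr₁ x)) (hs x)
  have hEB' : EB ∈ cutStabilizerDegree R g B n :=
    mem_cutStabilizerDegree_of_gen
      (fun x hx => by rw [hEB]; exact add_mem (add_mem (hpB_B x hx) (hr₂B x hx)) (hsB x hx))
      fun x => by rw [hEB]; exact add_mem (add_mem (hpB_grade x) (hr₂ x)) (hs x)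
  have hEC' : EC ∈ cutStabilizerDegree R g C n :=
    mem_cutStabilizerDegree_of_gen
      (fun x hx => by rw [hEC]; exact sub_mem (sub_mem (hpC_C x hx) (hr₁C x hx)) (hr₂C x hx))
      fun x => by rw [hEC]; exact sub_mem (sub_mem (hpC_grade x) (hr₁ x)) (hr₂ x)
  have hDE : D = EA + EB + EC := derivation_ext fun x => by
    rw [LieDerivation.add_apply, LieDerivation.add_apply, hEA, hEB, hEC]
    simp only [Pi.add_apply, Pi.sub_apply]
    rw [← hsum x]; abel
  rw [hDE]
  exact add_mem (add_mem (Submodule.mem_sup_left (Submodule.mem_sup_left hEA'))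
    (Submodule.mem_sup_left (Submodule.mem_sup_right hEB'))) (Submodule.mem_sup_right hEC')

end Decomposition

end Summit.SmoothPoincare4.SmoothPoincare4.Theorems.LieGateIdentity

namespace Summit.SmoothPoincare4.SmoothPoincare4.Theorems

open Literature.Algebra.Lie Literature.Algebra.Lie.SurfaceLieAlgebra LieGateIdentity

/-- **Every positive-degree derivation of `𝔰_{3+3m}(R)` decomposes along the `S⁴` trisection**:
`Der_n = 𝔞 + 𝔟 + 𝔠` for the degree-`n` stabilisers of the three cut ideals of
`s4CutSystem m 0, 1, 2` — the inclusion–exclusion form of the Lie gate identity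
(`lieGateIdentity`). [folklore] -/
theorem derDegree_eq_sup_cutStabilizerDegree (R : Type*) [CommRing R] (m n : ℕ) :
    derDegree R (3 + 3 * m) n =
      cutStabilizerDegree R (3 + 3 * m) (s4CutSystem m 0) n ⊔
        cutStabilizerDegree R (3 + 3 * m) (s4CutSystem m 1) n ⊔
          cutStabilizerDegree R (3 + 3 * m) (s4CutSystem m 2) n :=
  derDegree_eq_sup_three (s4CutSystem_coord m 0) (s4CutSystem_coord m 1) (s4CutSystem_coord m 2)
    (s4CutSystem_not_mem_three m (i := 0) (j := 1) (k := 2) (by decide) (by decide) (by decide)) n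

end Summit.SmoothPoincare4.SmoothPoincare4.Theorems
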